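import Mathlib.Analysis.InnerProductSpace.PiL2
import Mathlib.Analysis.SpecialFunctions.Pow.Real
import Literature.MathematicalPhysics.StatisticalMechanics.BarlowStacking
import HarnessLib

/-!
# Surface (Wulff) constants of the sticky-sphere energy on the fcc and hcp packings (Cicalese–Kreutz–Leonardi 2023)

Topic `Literature/MathematicalPhysics/StatisticalMechanics`; companion of `BarlowStacking.lean`
(the point sets `fccStacking a h`, `hcpStacking a h`).  Cell `crystal3d-full` (D-0046), asked for by
the planner memo `run/shared/lean/pub/crystal3d-full/cf-p1/ROUTE.md` §4 (`HcpSurfacePenalty`,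
"vendorable as a Literature fact") and the pre-registration `cf-p2/PREREG.md` (anchor S0-W).

## Source, as printed (M. Cicalese, L. Kreutz, G. P. Leonardi, *Emergence of Wulff-crystals from
atomistic systems on the FCC and HCP lattices*, Comm. Math. Phys. 402 (2023) = arXiv:2204.12892
[CicaleseKreutzLeonardi2023]; page/line references are to the arXiv text held in the hub store as
`paper:cicalese2023-emergence-wulff-crystals-from-atomistic-systems-fcc`)

* p. 2, (1)–(2): the sticky potential `V(r) = +∞ (r < 1), −1 (r = 1), 0` otherwise; for
  `X = {x₁,…,x_N} ⊂ L`, `L = L_FCC` or `L_HCP` with lattice spacing `1`,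
  `E(X) = ½ Σ_{i≠j} V(|xᵢ − xⱼ|) = −Σᵢ #(N(xᵢ) ∩ X)`, `N(x) = {y ∈ L : |x − y| = 1}`;
  "the minimal energy per atom is `−k(3) = −12`".
* p. 6: "Surface scaling of the configurational energy. For `ε > 0` such that `ε³ #X → 1` … we
  consider … `G_{L,ε}(X) := ε² Σ_{x∈X} (12 − #(N_ε(x) ∩ X))`"; (17)–(18): `E_{L,ε}` = `G_{L,ε}` on
  empirical measures `μ_ε = ε³ Σ δ_x`; (19)–(21): the homogenised density `φ_L` and the limit
  `E_L(μ) = ∫_{∂*V} φ_L(ν) dH²` if `μ = √2 𝓛³⌞V`.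
* p. 8–9, **Theorem 2.3** (i) compactness + "if `μ_ε` minimises `E_{L,ε}` among measures of mass
  `ε³ n_ε` with `ε³ n_ε → √2 v`, then `μ = √2 𝓛³⌞W^v_{φ_L}`" (the rescaled Wulff set of volume `v`);
  (ii) liminf inequality; (iii) limsup inequality.
* p. 3: "We show that `m_FCC < m_HCP` which also implies (since Γ-convergence and coercivity
  implies the convergence of minimum values) that, for large number of atoms, crystallization on
  the face-centered cubic lattice is preferred to that on the hexagonal-closed packed lattice."
* p. 10, **Proposition 2.4** (23)–(25): `φ_FCC(ν) = |ν₁+ν₂|+|ν₁+ν₃|+|ν₂+ν₃|+|ν₁−ν₂|+|ν₁−ν₃|+|ν₂−ν₃|`,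
  "`W_FCC` is a truncated octahedron and its surface energy per unit volume is
  `|W_FCC|^{−2/3} ∫_{∂*W_FCC} φ_FCC(ν) dH² = 3·2²·2^{2/3}`"; **Proposition 2.5** (26)–(28): "`W_HCP`
  is a truncated elongated hexagonal bipyramid and its surface energy per unit volume is
  `3·2^{2/3}·65^{1/3}`".

## Rendering (the arithmetic behind the two constants below)

Take `ε = N^{−1/3}` for configurations of exactly `N` points (so `ε³ #X = 1`).  Then
`G_{L,ε}(X) = N^{−2/3} · Σ_{x∈X}(12 − #(N(x) ∩ X)) = N^{−2/3} · (12N − 2 C(X)) = 2 N^{−2/3} D(X)`, where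
`C(X)` is the number of unordered contact pairs (distance exactly `1`) and `D(X) := 6N − C(X)` is the
*deficiency* (half the number of missing bonds).  The limit measures have mass `1 = √2 |V|`, i.e.
`|V| = 2^{−1/2}`, and the minimum of the limit energy at volume `v` is `c_L · v^{2/3}` with `c_L` the
printed surface energy per unit volume ((25), (28)).  Convergence of minimum values (p. 3) gives
`min_{#X = N} 2 N^{−2/3} D(X) → c_L · 2^{−1/3}`, i.e.
`min_{X ⊂ L, #X = N} D(X) / N^{2/3} → c_L · 2^{−4/3}`:
* fcc: `12·2^{2/3}·2^{−4/3} = 6·2^{1/3} = ∛432 = 7.5595…` (`gammaFcc`);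
* hcp: `3·2^{2/3}·65^{1/3}·2^{−4/3} = (3/2)·130^{1/3} = 7.5987…` (`gammaHcp`).
The host sets are `fccStacking 1 √(2/3)` and `hcpStacking 1 √(2/3)` (`BarlowStacking.lean`: in-layer
spacing `a = 1`, ideal layer spacing `h = a√(2/3)`, so nearest neighbours are exactly the points at
distance `1`, twelve of them — the paper's `L_FCC`, `L_HCP` with lattice spacing `1`, p. 2).
"Convergence of minimum values" is rendered as the two-sided statement `HasSurfaceConstant`
(every `N`-subset has `D ≥ (γ − ε)N^{2/3}` eventually, and some `N`-subset has `D ≤ (γ + ε)N^{2/3}`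
eventually), which is literally `min_N D / N^{2/3} → γ` without choosing a value for an `sInf`.

## Contents (namespace `Literature.MathematicalPhysics.StatisticalMechanics`)

* `orderedContacts X`, `contactDeficiency X` (`= 6·#X − ½·orderedContacts X`, a real number — no `ℕ`
  subtraction), `HasSurfaceConstant L γ`, the constants `gammaFcc`, `gammaHcp`;
* NAMED FACT `CicaleseKreutzLeonardi2023_surfaceConstants` — Theorem 2.3 + Propositions 2.4–2.5 +
  the convergence of minimum values, for the two hosts (one fact, one source);
* PROVED: `gammaFcc_pow_three` (`= 432`), `gammaHcp_pow_three` (`= 1755/4 = 438.75`),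
  `gammaFcc_lt_gammaHcp` ("FCC is preferred to HCP", the printed comparison `m_FCC < m_HCP` in
  deficiency units), and the corollary `hcpSurfacePenalty_of` : the fact ⇒ `∃ δ > 0`, eventually every `N`-subset of the hcp
  packing has deficiency `≥ (gammaFcc + δ) N^{2/3}` — the shape the cell's planner calls
  `HcpSurfacePenalty` (there over `Summits/Ventures/Crystal3D` packings; the bridge from injective
  `Fin N`-indexed packings to `Finset`s is left to the Summits side, which Literature cannot import).

WHAT IS NOT HERE: the Γ-convergence statement itself (measures, `BV`, Wulff sets), the formulas
(23)–(27) as functions, any claim about stackings other than fcc and hcp (the paper treats only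
these two hosts), anything off-lattice.
-/

noncomputable section

namespace Literature.MathematicalPhysics.StatisticalMechanics

open _root_.Real

/-- Euclidean `3`-space (local abbreviation). -/
local notation "E3" => EuclideanSpace ℝ (Fin 3)

/-- Number of ORDERED pairs `(x, y)` of points of `X` at distance exactly `1` (each contact counted
twice; the diagonal is excluded automatically since `dist x x = 0`).  For `X ⊂ L_FCC` or `L_HCP`
with nearest-neighbour distance `1` this is `Σ_{x ∈ X} #(N(x) ∩ X)` of the source, p. 2.
[cite: CicaleseKreutzLeonardi2023, §1 (2) and p. 2] -/
def orderedContacts (X : Finset E3) : ℕ :=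
  ((X ×ˢ X).filter fun p => dist p.1 p.2 = 1).card

/-- The deficiency `D(X) = 6·#X − C(X)`, `C(X)` = number of unordered contact pairs
`= ½ · orderedContacts X`; equals `½ Σ_{x∈X} (12 − #(N(x) ∩ X))`, i.e. one half of the source's
surface energy `G_{L,ε}` before the scaling factor `ε²` (p. 6).  Real-valued to avoid `ℕ`
subtraction. [cite: CicaleseKreutzLeonardi2023, p. 6 (definition of `G_{L,ε}`)] -/
def contactDeficiency (X : Finset E3) : ℝ :=
  6 * (X.card : ℝ) - (orderedContacts X : ℝ) / 2

/-- "`min_{X ⊂ L, #X = N} D(X) / N^{2/3} → γ`", stated two-sidedly without an `sInf`: for every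
`ε > 0`, eventually (in `N`) every `N`-point subset of `L` has deficiency `≥ (γ − ε) N^{2/3}`, and
eventually some `N`-point subset has deficiency `≤ (γ + ε) N^{2/3}`.  This is the "convergence of
minimum values" of the source (p. 3) in deficiency units.
[cite: CicaleseKreutzLeonardi2023, Theorem 2.3 and p. 3] -/
def HasSurfaceConstant (L : Set E3) (γ : ℝ) : Prop :=
  (∀ ε : ℝ, 0 < ε → ∃ N₀ : ℕ, ∀ N : ℕ, N₀ ≤ N → ∀ X : Finset E3, (↑X : Set E3) ⊆ L →
      X.card = N → (γ - ε) * (N : ℝ) ^ ((2 : ℝ) / 3) ≤ contactDeficiency X) ∧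
  (∀ ε : ℝ, 0 < ε → ∃ N₀ : ℕ, ∀ N : ℕ, N₀ ≤ N → ∃ X : Finset E3, (↑X : Set E3) ⊆ L ∧
      X.card = N ∧ contactDeficiency X ≤ (γ + ε) * (N : ℝ) ^ ((2 : ℝ) / 3))

/-- The fcc surface constant in deficiency units: `6·2^{1/3} = ∛432 = 7.5595…`
(`= 12·2^{2/3}·2^{−4/3}` from the printed `3·2²·2^{2/3}`, (25)).
[cite: CicaleseKreutzLeonardi2023, Proposition 2.4 (25)] -/
def gammaFcc : ℝ := 6 * (2 : ℝ) ^ ((1 : ℝ) / 3)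

/-- The hcp surface constant in deficiency units: `(3/2)·130^{1/3} = 7.5987…`
(`= 3·2^{2/3}·65^{1/3}·2^{−4/3}` from the printed `3·2^{2/3}·65^{1/3}`, (28)).
[cite: CicaleseKreutzLeonardi2023, Proposition 2.5 (28)] -/
def gammaHcp : ℝ := 3 / 2 * (130 : ℝ) ^ ((1 : ℝ) / 3)

/-- **Cicalese–Kreutz–Leonardi 2023 (Theorem 2.3 with Propositions 2.4, 2.5 and the convergence of
minimum values, p. 3), NAMED FACT.**  For the sticky-sphere energy restricted to the fcc packing
`L_FCC` (resp. the hcp packing `L_HCP`) of nearest-neighbour distance `1`, the minimal deficiency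
`min_{X ⊂ L, #X = N} (6N − C(X))` is asymptotic to `γ N^{2/3}` with `γ = 6·2^{1/3}` for fcc and
`γ = (3/2)·130^{1/3}` for hcp (the printed surface energies per unit volume `3·2²·2^{2/3}` and
`3·2^{2/3}·65^{1/3}` of the Wulff shapes — a truncated octahedron, resp. a truncated elongated
hexagonal bipyramid — rescaled as explained in the module docstring).  Hosts:
`fccStacking 1 √(2/3)`, `hcpStacking 1 √(2/3)` of `BarlowStacking.lean`.
[cite: CicaleseKreutzLeonardi2023, Theorem 2.3, Proposition 2.4 (25), Proposition 2.5 (28), p. 3] -/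
def CicaleseKreutzLeonardi2023_surfaceConstants : Prop :=
  HasSurfaceConstant (fccStacking 1 (√(2 / 3))) gammaFcc ∧
    HasSurfaceConstant (hcpStacking 1 (√(2 / 3))) gammaHcp

/-! ### Proved bookkeeping -/

/-- `(6·2^{1/3})³ = 432`: the printed fcc constant `3·2²·2^{2/3}` of (25) in deficiency units is
`∛432` (arithmetic rendering, see the module docstring). [cite: CicaleseKreutzLeonardi2023, Proposition 2.4 (25)] -/
theorem gammaFcc_pow_three : gammaFcc ^ 3 = 432 := by
  unfold gammaFcc
  have h2 : ((2 : ℝ) ^ ((1 : ℝ) / 3)) ^ 3 = 2 := by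
    rw [← Real.rpow_natCast, ← Real.rpow_mul (by norm_num : (0 : ℝ) ≤ 2)]
    norm_num
  rw [mul_pow, h2]; norm_num

/-- `((3/2)·130^{1/3})³ = 1755/4 = 438.75`: the printed hcp constant `3·2^{2/3}·65^{1/3}` of (28) in
deficiency units, cubed (arithmetic rendering, see the module docstring).
[cite: CicaleseKreutzLeonardi2023, Proposition 2.5 (28)] -/
theorem gammaHcp_pow_three : gammaHcp ^ 3 = 1755 / 4 := by
  unfold gammaHcp
  have h130 : ((130 : ℝ) ^ ((1 : ℝ) / 3)) ^ 3 = 130 := by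
    rw [← Real.rpow_natCast, ← Real.rpow_mul (by norm_num : (0 : ℝ) ≤ 130)]
    norm_num
  rw [mul_pow, h130]; norm_num

/-- `0 < 6·2^{1/3}` (helper). [folklore] -/
private theorem gammaFcc_pos : 0 < gammaFcc := by
  unfold gammaFcc; positivity

/-- `0 < (3/2)·130^{1/3}` (helper). [folklore] -/
private theorem gammaHcp_pos : 0 < gammaHcp := by
  unfold gammaHcp; positivity

/-- **"FCC is preferred to HCP"** (the printed comparison `m_FCC < m_HCP`, p. 3, in deficiency
units): `6·2^{1/3} < (3/2)·130^{1/3}`, since `432 < 438.75`.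
[cite: CicaleseKreutzLeonardi2023, p. 3 and (25), (28)] -/
theorem gammaFcc_lt_gammaHcp : gammaFcc < gammaHcp := by
  refine lt_of_pow_lt_pow_left₀ 3 gammaHcp_pos.le ?_
  rw [gammaFcc_pow_three, gammaHcp_pow_three]
  norm_num

/-- **Corollary (the shape `HcpSurfacePenalty` of the cell's planner memo, in Literature
vocabulary).**  From the named fact: there is `δ > 0` (namely `(γ_hcp − γ_fcc)/2`) such that
eventually every `N`-point subset of the hcp packing has deficiency at least
`(gammaFcc + δ) N^{2/3}` — strictly more missing bonds, at order `N^{2/3}`, than the fcc value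
allows.  [cite: CicaleseKreutzLeonardi2023, Theorem 2.3, (25), (28), p. 3] -/
theorem hcpSurfacePenalty_of (h : CicaleseKreutzLeonardi2023_surfaceConstants) :
    ∃ δ : ℝ, 0 < δ ∧ ∃ N₀ : ℕ, ∀ N : ℕ, N₀ ≤ N → ∀ X : Finset E3,
      (↑X : Set E3) ⊆ hcpStacking 1 (√(2 / 3)) → X.card = N →
        (gammaFcc + δ) * (N : ℝ) ^ ((2 : ℝ) / 3) ≤ contactDeficiency X := by
  obtain ⟨-, hhcp⟩ := h
  obtain ⟨hlow, -⟩ := hhcp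
  set δ : ℝ := (gammaHcp - gammaFcc) / 2 with hδ
  have hδpos : 0 < δ := by
    have := gammaFcc_lt_gammaHcp
    rw [hδ]; linarith
  obtain ⟨N₀, hN₀⟩ := hlow δ hδpos
  refine ⟨δ, hδpos, N₀, fun N hN X hX hcard => ?_⟩
  have key := hN₀ N hN X hX hcard
  have hγ : gammaHcp - δ = gammaFcc + δ := by rw [hδ]; ring
  rw [hγ] at key
  exact key

end Literature.MathematicalPhysics.StatisticalMechanics

end
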